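import Literature.Computability.MetaComplexity.SearchHeuristicSchemesHardE
import Literature.Computability.MetaComplexity.AvgCaseDerandomizationPCP
import Literature.Computability.Complexity.ScaledPCPAssembly
import HarnessLib

/-!
# Complexity meta: Hirahara 2021, Thm. 8.9 (`UP` form), Cor. 8.12 (`UP`), Thm. 4.2 and Lemma 5.1 relative to ONE leaf — PCPs for `E`

Topic `Literature/Computability/MetaComplexity`, fourth proof file of the named fact
`Hirahara2021_UP_searchUHS_of_Avg1P` (S. Hirahara, *Average-case hardness of NP from exponential
worst-case hardness assumptions*, ECCC TR21-058 / STOC 2021, Thm. 8.9 for `UP`-type verifiers) and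
companion of `LanguageCompressionHardE.lean` (Thm. 4.2). `SearchHeuristicSchemesHardE.lean` reduced
these facts to Buhrman–Fortnow–Pavan's Lemma 3.7 under Hirahara's hypothesis
(`Hirahara2021_UP_searchUHS_of_Avg1P_of_lemma37`, `Hirahara2021_hardE_of_lemma37`); the tree now proves
that lemma along its printed proof from BFP's **Thm. 3.3** — probabilistically checkable proofs for
`E` (Babai–Fortnow–Levin–Szegedy 1991 / Polishchuk–Spielman 1994) in the tree's `PCPVerifier` model —
(`Hirahara2021_lemma37_of_pcp`, `AvgCaseDerandomizationPCP.lean`). Hence Thm. 8.9 (`UP`), Cor. 8.12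
(`UP`), Thm. 4.2 and Lemma 5.1 all follow from that single published theorem:

* **`Hirahara2021_UP_searchUHS_of_Avg1P_of_pcp`**, **`Hirahara2021_UP_hasUHS_of_Avg1P_of_pcp`**,
  **`Hirahara2021_languageCompression_of_pcp`**, **`Hirahara2021_gapKvsK_mem_PromiseP_of_pcp`**.

No definitions, no named facts (D-0026).

## References

* S. Hirahara, ECCC TR21-058 (2021): Thm. 8.9, Cor. 8.12, Thm. 4.2, Lemma 5.1, Lemma 3.4 (proof
  sketch, p. 20) [Hirahara2021].
* H. Buhrman, L. Fortnow, A. Pavan, *Some results on derandomization*, Theory Comput. Syst. 38 (2005),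
  Thm. 3.3, Lemma 3.4, Lemma 3.7 [BuhrmanFortnowPavan2004].
-/

namespace Literature.Computability.MetaComplexity

open _root_.Computability Polynomial Complexity Complexity.Classes Complexity.Nondeterministic Filter

/-- **Hirahara 2021, Thm. 8.9 (`UP` form), from PCPs for `E` alone** (BFP Thm. 3.3 in the tree's
`PCPVerifier` model, the hypothesis of `BFP_lemma37_of_pcp`).
[cite: Hirahara2021, Thm. 8.9 (proof, pp. 40–42) and Lemma 3.4 (proof sketch, p. 20)]
[cite: BuhrmanFortnowPavan2004, Thm. 3.3] -/
theorem Hirahara2021_UP_searchUHS_of_Avg1P_of_pcp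
    (hPCP : ∀ A ∈ E, ∃ (V : PCPVerifier) (P : List Bool → List Bool) (p : Polynomial ℕ), V.IsPolyTime ∧
      (∀ n, V.coins n = p.eval n) ∧ P ∈ FE ∧
      (∀ x ∈ A, V.acceptProb x (fun i => (P x).getD i false) = 1) ∧
      (∀ x ∉ A, ∀ π : ℕ → Bool, V.acceptProb x π ≤ 1 / 2)) :
    Hirahara2021_UP_searchUHS_of_Avg1P :=
  Hirahara2021_UP_searchUHS_of_Avg1P_of_lemma37 (Hirahara2021_lemma37_of_pcp hPCP)

/-- **Hirahara 2021, Cor. 8.12 for `UP`, from PCPs for `E` alone**: under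
`coNP × {U, T} ⊆ Avg¹_{1-n^{-c}}P` every `L ∈ UP` admits a universal heuristic scheme.
[cite: Hirahara2021, Cor. 8.12 and Thm. 8.9] [cite: BuhrmanFortnowPavan2004, Thm. 3.3] -/
theorem Hirahara2021_UP_hasUHS_of_Avg1P_of_pcp
    (hPCP : ∀ A ∈ E, ∃ (V : PCPVerifier) (P : List Bool → List Bool) (p : Polynomial ℕ), V.IsPolyTime ∧
      (∀ n, V.coins n = p.eval n) ∧ P ∈ FE ∧
      (∀ x ∈ A, V.acceptProb x (fun i => (P x).getD i false) = 1) ∧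
      (∀ x ∉ A, ∀ π : ℕ → Bool, V.acceptProb x π ≤ 1 / 2)) :
    ∀ U : UniversalMachine,
      (∃ c : ℕ, distClass coNP {uniformEnsemble, tallyEnsemble} ⊆
        Avg1DeltaP fun n => 1 - 1 / (n : ℝ) ^ c) →
      ∀ L ∈ UP, U.HasUniversalHeuristicScheme L :=
  Hirahara2021_UP_hasUHS_of_Avg1P_of_lemma37 (Hirahara2021_lemma37_of_pcp hPCP)

/-- **Hirahara 2021, Thm. 4.2 (algorithmic language compression), from PCPs for `E` alone**: the named
fact `Hirahara2021_languageCompression` from BFP's Thm. 3.3 (`Hirahara2021_languageCompression_of_hardE`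
fed with the hard language of `Hirahara2021_hardE_of_lemma37` and `Hirahara2021_lemma37_of_pcp`).
[cite: Hirahara2021, Thm. 4.2 and Lemma 3.4 (proof sketch, p. 20)] [cite: BuhrmanFortnowPavan2004, Thm. 3.3] -/
theorem Hirahara2021_languageCompression_of_pcp
    (hPCP : ∀ A ∈ E, ∃ (V : PCPVerifier) (P : List Bool → List Bool) (p : Polynomial ℕ), V.IsPolyTime ∧
      (∀ n, V.coins n = p.eval n) ∧ P ∈ FE ∧
      (∀ x ∈ A, V.acceptProb x (fun i => (P x).getD i false) = 1) ∧
      (∀ x ∉ A, ∀ π : ℕ → Bool, V.acceptProb x π ≤ 1 / 2)) :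
    Hirahara2021_languageCompression :=
  Hirahara2021_languageCompression_of_hardE fun hyp =>
    Hirahara2021_hardE_of_lemma37 hyp (Hirahara2021_lemma37_of_pcp hPCP hyp)

/-- **Hirahara 2021, Lemma 5.1 (`Gap(K vs K) ∈ pr-P`), from PCPs for `E` alone** (Thm. 4.2 applied to
the `NP` ensemble `{x | K^t(x) ≤ s}`, `Hirahara2021_gapKvsK_mem_PromiseP_of_languageCompression`).
[cite: Hirahara2021, Lemma 5.1 (proof, p. 29)] [cite: BuhrmanFortnowPavan2004, Thm. 3.3] -/
theorem Hirahara2021_gapKvsK_mem_PromiseP_of_pcp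
    (hPCP : ∀ A ∈ E, ∃ (V : PCPVerifier) (P : List Bool → List Bool) (p : Polynomial ℕ), V.IsPolyTime ∧
      (∀ n, V.coins n = p.eval n) ∧ P ∈ FE ∧
      (∀ x ∈ A, V.acceptProb x (fun i => (P x).getD i false) = 1) ∧
      (∀ x ∉ A, ∀ π : ℕ → Bool, V.acceptProb x π ≤ 1 / 2)) :
    Hirahara2021_gapKvsK_mem_PromiseP :=
  Hirahara2021_gapKvsK_mem_PromiseP_of_languageCompression (Hirahara2021_languageCompression_of_pcp hPCP)


/-! ### The discharges: PCPs for `E` exist (`ScaledPCP.exists_pcp_of_mem_E`) -/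

/-- **Hirahara 2021, Thm. 8.9 (`UP` form) — DISCHARGED.** The hypothesis of the `_of_pcp` reductions
above, Buhrman–Fortnow–Pavan's Thm. 3.3 in the tree's `PCPVerifier` model (every `A ∈ E` has a
polynomial-time PCP verifier with exactly polynomially many coins, an `FE`-computable proof accepted
with probability `1`, and soundness error `≤ 1/2`), is the theorem `ScaledPCP.exists_pcp_of_mem_E` of
`Literature/Computability/Complexity/ScaledPCPAssembly.lean` (the Babai–Fortnow–Lund / BFLS verifier
scaled to `E`: `ScaledPCPVerifier.lean` and its machine layer).
[cite: Hirahara2021, Thm. 8.9 (proof, pp. 40–42)] [cite: BuhrmanFortnowPavan2004, Thm. 3.3]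
[cite: BabaiFortnowLund1991, §4–§7] -/
theorem Hirahara2021_UP_searchUHS_of_Avg1P_holds : Hirahara2021_UP_searchUHS_of_Avg1P :=
  Hirahara2021_UP_searchUHS_of_Avg1P_of_pcp ScaledPCP.exists_pcp_of_mem_E

/-- **Hirahara 2021, Thm. 4.2 (language compression) — DISCHARGED** through the same PCPs.
[cite: Hirahara2021, Thm. 4.2 (proof, pp. 21–23)] [cite: BuhrmanFortnowPavan2004, Thm. 3.3] -/
theorem Hirahara2021_languageCompression_holds : Hirahara2021_languageCompression :=
  Hirahara2021_languageCompression_of_pcp ScaledPCP.exists_pcp_of_mem_E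

/-- **Hirahara 2021, Lemma 5.1 (`Gap(K vs K) ∈ pr-P`) — DISCHARGED** through the same PCPs.
[cite: Hirahara2021, Lemma 5.1 (proof, p. 29)] [cite: BuhrmanFortnowPavan2004, Thm. 3.3] -/
theorem Hirahara2021_gapKvsK_mem_PromiseP_holds : Hirahara2021_gapKvsK_mem_PromiseP :=
  Hirahara2021_gapKvsK_mem_PromiseP_of_pcp ScaledPCP.exists_pcp_of_mem_E

/-- **Hirahara 2021, Cor. 8.12 for `UP` — unconditionally on PCPs**: under
`coNP × {U, T} ⊆ Avg¹_{1-n^{-c}}P` every `L ∈ UP` admits a universal heuristic scheme.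
[cite: Hirahara2021, Cor. 8.12 and Thm. 8.9] -/
theorem Hirahara2021_UP_hasUHS_of_Avg1P' : ∀ U : UniversalMachine,
    (∃ c : ℕ, distClass coNP {uniformEnsemble, tallyEnsemble} ⊆ Avg1DeltaP fun n => 1 - 1 / (n : ℝ) ^ c) →
      ∀ L ∈ UP, U.HasUniversalHeuristicScheme L :=
  Hirahara2021_UP_hasUHS_of_Avg1P_of_pcp ScaledPCP.exists_pcp_of_mem_E

end Literature.Computability.MetaComplexity
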